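import Summits.CriticalPhenomena.Ising3DConformalLimit.Theorems.SynchronousCouplingRotationJoiningIsotropyDefs
import Summits.CriticalPhenomena.Ising3DConformalLimit.Theorems.SynchronousCouplingJoiningsTransfer
import Summits.CriticalPhenomena.Ising3DConformalLimit.Theorems.HyperoctahedralRPExistsScaleCovariantLimitTwoPointScalingOfLattice
import Summits.CriticalPhenomena.Ising3DConformalLimit.Theorems.HyperoctahedralRPExistsScaleCovariantLimitBlockCovAlgebra
import Summits.CriticalPhenomena.Ising3DConformalLimit.Theorems.HyperoctahedralRPExistsScaleCovariantLimitBlockCovTwoPointBounds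
import Literature.Probability.LatticeModels.CriticalTwoPointBounds
import HarnessLib

/-!
# Route `SynchronousCoupling`, crux `RotationJoining` (stmt-CriticalPhenomena-18763), line `SketchIdeator2`,
# reshape 2 — stub `stub_twoPointToolkit`: the block-variance toolkit

`Sig.stub_twoPointToolkit : DilationJoinings → UniformRegularity → TwoPointToolkit`, where `TwoPointToolkit`
(Theorems/SynchronousCouplingRotationJoiningIsotropyDefs.lean) asks for ONE pair `L₀ ≥ 1`, `A ≥ 1` with, for the
block variance `V(L) = blockCov L 0 = Σ_{x,y ∈ cube L} ⟨σ_xσ_y⟩_{β_c}` of the critical nearest-neighbour Ising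
model on `ℤ³`,
* (a) UPPER DOUBLING `V(2L) ≤ A V(L)` for `L ≥ L₀`, and
* (b) SUPER-CUBIC GROWTH `V(ℓ) L^{7/2} ≤ A ℓ^{7/2} V(L)` for `L₀ ≤ ℓ ≤ L`.

Route (all inputs in tree).
1. `DilationJoinings ∧ UniformRegularity ⇒ BlockLimits` (`Cruxes.JoiningsTransfer.Sketch.blockLimits_of_joinings`),
   `BlockLimits ⇒ BlockTwoLimits` (order `n = 2`), and
   `stub_twoPointScaling_of_lattice stub_blockCovAlgebra stub_blockCovTwoPointBounds : BlockTwoLimits → TwoPointScaling`: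
   (i) `φ(m) = m⁶ g(m)/V(m) → Φ > 0` and (ii) `g(2m)/g(m) → r` (`g(m) = ⟨σ₀σ_{m e₀}⟩_{β_c}`).
2. `V(2m)/V(m) = 64 · (g(2m)/g(m)) · φ(m)/φ(2m) → 64 r`.
3. `r ≥ 1/4`: otherwise `g(2m) ≤ q g(m)` eventually with `q < 1/4`, so `g(2ⁱm₀) ≤ qⁱ g(m₀)`, against the
   infrared lower bound `g(n) ≥ c n⁻²` (`criticalTwoPoint_bounds_holds`), since `(4q)ⁱ → 0`.
4. Hence eventually `12 V(m) ≤ V(2m) ≤ (64 r + 1) V(m)`; (a) is immediate, and (b) follows by iterating the lower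
   doubling along `ℓ, 2ℓ, …, 2ⁱℓ ≤ L < 2^{i+1}ℓ` (`V` monotone): `L^{7/2} ≤ (2^{7/2})^{i+1} ℓ^{7/2} ≤ 12·12ⁱ ℓ^{7/2}`
   (`2^{7/2} < 12`) and `12ⁱ V(ℓ) ≤ V(2ⁱℓ) ≤ V(L)`. `A = max (64 r + 1) 12`.

No definitions, no named-fact hypotheses, no `sorry`.
-/

noncomputable section

namespace Summit.CriticalPhenomena.Ising3DConformalLimit.Cruxes.RotationJoining.RateSplitting

open Filter Literature.Probability.LatticeModels
open scoped Topology
open Summit.CriticalPhenomena.Ising3DConformalLimit.Cruxes.ExistsScaleCovariantLimit.MonotoneBlockingPort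
open Summit.CriticalPhenomena.Ising3DConformalLimit.Cruxes.JoiningsTransfer.Sketch (blockLimits_of_joinings)
open Summit.CriticalPhenomena.Ising3DConformalLimit.Theses

/-! ## Real analysis -/

/-- `2^{7/2} < 12` (`2⁷ = 128 < 144`). [folklore] -/
private theorem two_rpow_seven_halves_lt : (2 : ℝ) ^ (7 / 2 : ℝ) < 12 := by
  have h : ((2 : ℝ) ^ (7 / 2 : ℝ)) ^ 2 < 12 ^ 2 := by
    rw [← Real.rpow_mul_natCast zero_le_two]
    norm_num
  exact lt_of_pow_lt_pow_left₀ 2 (by norm_num) h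

/-- `(2ⁿ)^{7/2} = (2^{7/2})ⁿ`. [folklore] -/
private theorem two_pow_rpow (n : ℕ) : ((2 : ℝ) ^ n) ^ (7 / 2 : ℝ) = ((2 : ℝ) ^ (7 / 2 : ℝ)) ^ n := by
  rw [← Real.rpow_natCast_mul zero_le_two, mul_comm, Real.rpow_mul_natCast zero_le_two]

/-- SUPER-CUBIC GROWTH from eventual lower doubling `12 V(m) ≤ V(2m)` (`m ≥ L₀ ≥ 1`) of a monotone sequence that
is positive from `1` on: `V(ℓ) L^{7/2} ≤ 12 ℓ^{7/2} V(L)` for `L₀ ≤ ℓ ≤ L` (dyadic iteration, `2^{7/2} < 12`).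
[folklore] -/
private theorem superCubic_of_lowerDoubling {V : ℕ → ℝ} {L₀ : ℕ} (hL₀ : 1 ≤ L₀) (hVmono : Monotone V)
    (hVpos : ∀ L, 1 ≤ L → 0 < V L) (hlow : ∀ m, L₀ ≤ m → 12 * V m ≤ V (2 * m))
    (ℓ L : ℕ) (hℓ : L₀ ≤ ℓ) (hℓL : ℓ ≤ L) :
    V ℓ * (L : ℝ) ^ (7 / 2 : ℝ) ≤ 12 * (ℓ : ℝ) ^ (7 / 2 : ℝ) * V L := by
  have hiter : ∀ i : ℕ, 12 ^ i * V ℓ ≤ V (2 ^ i * ℓ) := by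
    intro i
    induction i with
    | zero => simp
    | succ i ih =>
      calc (12 : ℝ) ^ (i + 1) * V ℓ = 12 * (12 ^ i * V ℓ) := by rw [pow_succ]; ring
        _ ≤ 12 * V (2 ^ i * ℓ) := mul_le_mul_of_nonneg_left ih (by norm_num)
        _ ≤ V (2 * (2 ^ i * ℓ)) := hlow _ (hℓ.trans (Nat.le_mul_of_pos_left ℓ (pow_pos two_pos i)))
        _ = V (2 ^ (i + 1) * ℓ) := by rw [pow_succ, mul_comm (2 ^ i) 2, mul_assoc]
  have hℓ1 : 1 ≤ ℓ := hL₀.trans hℓ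
  obtain ⟨i, h1, h2⟩ : ∃ i : ℕ, 2 ^ i * ℓ ≤ L ∧ L < 2 ^ (i + 1) * ℓ :=
    ⟨Nat.log 2 (L / ℓ), (Nat.le_div_iff_mul_le hℓ1).1 (Nat.pow_log_le_self 2 (Nat.div_pos hℓL hℓ1).ne'),
      (Nat.div_lt_iff_lt_mul hℓ1).1 (Nat.lt_pow_succ_log_self one_lt_two _)⟩
  have hVℓ : 0 ≤ V ℓ := (hVpos ℓ hℓ1).le
  have hL' : (L : ℝ) ≤ (2 : ℝ) ^ (i + 1) * ℓ := by exact_mod_cast h2.le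
  have hpow : (L : ℝ) ^ (7 / 2 : ℝ) ≤ 12 ^ (i + 1) * (ℓ : ℝ) ^ (7 / 2 : ℝ) :=
    calc (L : ℝ) ^ (7 / 2 : ℝ) ≤ ((2 : ℝ) ^ (i + 1) * ℓ) ^ (7 / 2 : ℝ) :=
          Real.rpow_le_rpow (Nat.cast_nonneg _) hL' (by norm_num)
      _ = ((2 : ℝ) ^ (7 / 2 : ℝ)) ^ (i + 1) * (ℓ : ℝ) ^ (7 / 2 : ℝ) := by
          rw [Real.mul_rpow (by positivity) (Nat.cast_nonneg _), two_pow_rpow]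
      _ ≤ 12 ^ (i + 1) * (ℓ : ℝ) ^ (7 / 2 : ℝ) :=
          mul_le_mul_of_nonneg_right (pow_le_pow_left₀ (by positivity) two_rpow_seven_halves_lt.le _)
            (by positivity)
  calc V ℓ * (L : ℝ) ^ (7 / 2 : ℝ) ≤ V ℓ * (12 ^ (i + 1) * (ℓ : ℝ) ^ (7 / 2 : ℝ)) :=
        mul_le_mul_of_nonneg_left hpow hVℓ
    _ = 12 * (ℓ : ℝ) ^ (7 / 2 : ℝ) * (12 ^ i * V ℓ) := by rw [pow_succ]; ring
    _ ≤ 12 * (ℓ : ℝ) ^ (7 / 2 : ℝ) * V (2 ^ i * ℓ) := mul_le_mul_of_nonneg_left (hiter i) (by positivity)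
    _ ≤ 12 * (ℓ : ℝ) ^ (7 / 2 : ℝ) * V L := mul_le_mul_of_nonneg_left (hVmono h1) (by positivity)

/-- THE RATIO LIMIT IS AT LEAST `1/4`: if `g > 0` satisfies `g(n) ≥ c n⁻²` (`n ≥ 1`, `c > 0`) and
`g(2m)/g(m) → r`, then `1/4 ≤ r` (otherwise `g(2ⁱm₀) ≤ qⁱ g(m₀)` with `4q < 1`, so `c ≤ (4q)ⁱ m₀² g(m₀) → 0`).
[folklore] -/
private theorem quarter_le_ratioLimit {g : ℕ → ℝ} {c r : ℝ} (hgp : ∀ m, 0 < g m) (hc : 0 < c)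
    (hIR : ∀ n : ℕ, 1 ≤ n → c / (n : ℝ) ^ 2 ≤ g n)
    (hr : Tendsto (fun m : ℕ => g (2 * m) / g m) atTop (𝓝 r)) : 1 / 4 ≤ r := by
  by_contra h
  push Not at h
  obtain ⟨q, hrq, hq⟩ := exists_between h
  obtain ⟨m₀, hm₀⟩ := eventually_atTop.1 ((hr.eventually (gt_mem_nhds hrq)).and (eventually_ge_atTop 1))
  have hm₀1 : 1 ≤ m₀ := (hm₀ m₀ le_rfl).2
  have hq0 : 0 ≤ q := ((div_pos (hgp _) (hgp _)).trans (hm₀ m₀ le_rfl).1).le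
  have hstep : ∀ m, m₀ ≤ m → g (2 * m) ≤ q * g m := fun m hm => by
    have h1 := (hm₀ m hm).1
    rw [div_lt_iff₀ (hgp m)] at h1
    exact h1.le
  have hiter : ∀ i : ℕ, g (2 ^ i * m₀) ≤ q ^ i * g m₀ := by
    intro i
    induction i with
    | zero => simp
    | succ i ih =>
      calc g (2 ^ (i + 1) * m₀) = g (2 * (2 ^ i * m₀)) := by rw [pow_succ, mul_comm (2 ^ i) 2, mul_assoc]
        _ ≤ q * g (2 ^ i * m₀) := hstep _ (le_trans (Nat.le_mul_of_pos_left m₀ (pow_pos two_pos i)) le_rfl)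
        _ ≤ q * (q ^ i * g m₀) := mul_le_mul_of_nonneg_left ih hq0
        _ = q ^ (i + 1) * g m₀ := by rw [pow_succ]; ring
  have hfin : ∀ i : ℕ, c ≤ (4 * q) ^ i * ((m₀ : ℝ) ^ 2 * g m₀) := by
    intro i
    have hn : 1 ≤ 2 ^ i * m₀ := hm₀1.trans (Nat.le_mul_of_pos_left m₀ (pow_pos two_pos i))
    have h1 := (hIR _ hn).trans (hiter i)
    have hpos : (0 : ℝ) < ((2 ^ i * m₀ : ℕ) : ℝ) ^ 2 := by positivity
    rw [div_le_iff₀ hpos] at h1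
    have h4 : ((2 ^ i * m₀ : ℕ) : ℝ) ^ 2 = 4 ^ i * (m₀ : ℝ) ^ 2 := by
      push_cast
      rw [mul_pow, ← pow_mul, mul_comm i 2, pow_mul]
      norm_num
    calc c ≤ q ^ i * g m₀ * ((2 ^ i * m₀ : ℕ) : ℝ) ^ 2 := h1
      _ = (4 * q) ^ i * ((m₀ : ℝ) ^ 2 * g m₀) := by rw [h4, mul_pow]; ring
  have hlim : Tendsto (fun i : ℕ => (4 * q) ^ i * ((m₀ : ℝ) ^ 2 * g m₀)) atTop
      (𝓝 (0 * ((m₀ : ℝ) ^ 2 * g m₀))) :=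
    (tendsto_pow_atTop_nhds_zero_of_lt_one (by positivity) (by linarith)).mul_const _
  rw [zero_mul] at hlim
  have := ge_of_tendsto' hlim hfin
  linarith

/-- `V(2m)/V(m) → 64 r` from `φ(m) = m⁶ g(m)/V(m) → Φ > 0` and `g(2m)/g(m) → r`. [folklore] -/
private theorem covRatio_tendsto {g V : ℕ → ℝ} {Φ r : ℝ} (hgp : ∀ m, 0 < g m)
    (hVpos : ∀ L, 1 ≤ L → 0 < V L) (hΦ : 0 < Φ)
    (hφ : Tendsto (fun m : ℕ => (m : ℝ) ^ 6 * g m / V m) atTop (𝓝 Φ))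
    (hr : Tendsto (fun m : ℕ => g (2 * m) / g m) atTop (𝓝 r)) :
    Tendsto (fun m : ℕ => V (2 * m) / V m) atTop (𝓝 (64 * r)) := by
  have h2m : Tendsto (fun m : ℕ => 2 * m) atTop atTop :=
    tendsto_atTop_mono (fun m => Nat.le_mul_of_pos_left m two_pos) tendsto_id
  have h := (hr.const_mul 64).mul (hφ.div (hφ.comp h2m) hΦ.ne')
  rw [div_self hΦ.ne', mul_one] at h
  refine h.congr' ?_
  filter_upwards [eventually_ge_atTop 1] with m hm
  have hm0 : (m : ℝ) ≠ 0 := Nat.cast_ne_zero.2 (by omega)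
  have hg0 : g m ≠ 0 := (hgp m).ne'
  have hg2 : g (2 * m) ≠ 0 := (hgp _).ne'
  have hV0 : V m ≠ 0 := (hVpos m hm).ne'
  have hV2 : V (2 * m) ≠ 0 := (hVpos _ (by omega)).ne'
  simp only [Pi.div_apply, Function.comp_apply]
  push_cast
  field_simp
  ring

/-- THE TOOLKIT IN THE ABSTRACT SETTING: `g > 0` with `g(n) ≥ c n⁻²`, `V` monotone and positive from `1` on,
`m⁶ g(m)/V(m) → Φ > 0`, `g(2m)/g(m) → r` give `L₀ ≥ 1`, `A ≥ 1` with `V(2L) ≤ A V(L)` (`L ≥ L₀`) and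
`V(ℓ) L^{7/2} ≤ A ℓ^{7/2} V(L)` (`L₀ ≤ ℓ ≤ L`). [folklore] -/
private theorem toolkit_abstract {g V : ℕ → ℝ} {Φ r c : ℝ}
    (hgp : ∀ m, 0 < g m) (hVpos : ∀ L, 1 ≤ L → 0 < V L) (hVmono : Monotone V)
    (hc : 0 < c) (hIR : ∀ n : ℕ, 1 ≤ n → c / (n : ℝ) ^ 2 ≤ g n)
    (hΦ : 0 < Φ) (hφ : Tendsto (fun m : ℕ => (m : ℝ) ^ 6 * g m / V m) atTop (𝓝 Φ))
    (hr : Tendsto (fun m : ℕ => g (2 * m) / g m) atTop (𝓝 r)) :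
    ∃ L₀ : ℕ, 1 ≤ L₀ ∧ ∃ A : ℝ, 1 ≤ A ∧
      (∀ L : ℕ, L₀ ≤ L → V (2 * L) ≤ A * V L) ∧
      (∀ ℓ L : ℕ, L₀ ≤ ℓ → ℓ ≤ L → V ℓ * (L : ℝ) ^ (7 / 2 : ℝ) ≤ A * (ℓ : ℝ) ^ (7 / 2 : ℝ) * V L) := by
  have hW := covRatio_tendsto hgp hVpos hΦ hφ hr
  have h12 : (12 : ℝ) < 64 * r := by linarith [quarter_le_ratioLimit hgp hc hIR hr]
  obtain ⟨L₀, hL₀⟩ := eventually_atTop.1 ((hW.eventually (lt_mem_nhds h12)).and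
    ((hW.eventually (gt_mem_nhds (lt_add_one (64 * r)))).and (eventually_ge_atTop 1)))
  have hL₀1 : 1 ≤ L₀ := (hL₀ L₀ le_rfl).2.2
  have hlow : ∀ m, L₀ ≤ m → 12 * V m ≤ V (2 * m) := fun m hm => by
    obtain ⟨h1, -, h3⟩ := hL₀ m hm
    rw [lt_div_iff₀ (hVpos m h3)] at h1
    exact h1.le
  have hup : ∀ m, L₀ ≤ m → V (2 * m) ≤ (64 * r + 1) * V m := fun m hm => by
    obtain ⟨-, h2, h3⟩ := hL₀ m hm
    rw [div_lt_iff₀ (hVpos m h3)] at h2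
    exact h2.le
  refine ⟨L₀, hL₀1, max (64 * r + 1) 12, le_trans (by norm_num) (le_max_right _ _), fun L hL => ?_,
    fun ℓ L hℓ hℓL => ?_⟩
  · exact (hup L hL).trans (mul_le_mul_of_nonneg_right (le_max_left _ _) (hVpos L (hL₀1.trans hL)).le)
  · calc V ℓ * (L : ℝ) ^ (7 / 2 : ℝ) ≤ 12 * (ℓ : ℝ) ^ (7 / 2 : ℝ) * V L :=
          superCubic_of_lowerDoubling hL₀1 hVmono hVpos hlow ℓ L hℓ hℓL
      _ ≤ max (64 * r + 1) 12 * (ℓ : ℝ) ^ (7 / 2 : ℝ) * V L :=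
          mul_le_mul_of_nonneg_right (mul_le_mul_of_nonneg_right (le_max_right _ _) (by positivity))
            (hVpos L (hL₀1.trans (hℓ.trans hℓL))).le

/-! ## Lattice input: the infrared lower bound on the axis -/

/-- `⟨σ₀σ_{n e₀}⟩_{β_c} ≥ c n⁻²` for `n ≥ 1` on `ℤ³` (Simon–Lieb / infrared lower bound
`criticalTwoPoint_bounds_holds`, `‖n e₀‖_∞ = n`). [folklore] -/
private theorem axis_lower : ∃ c : ℝ, 0 < c ∧ ∀ n : ℕ, 1 ≤ n →
    c / (n : ℝ) ^ 2 ≤ criticalTwoPoint 3 (Pi.single 0 (n : ℤ)) := by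
  obtain ⟨c, C, hc, hb⟩ := criticalTwoPoint_bounds_holds (d := 3) le_rfl
  refine ⟨c, hc, fun n hn => ?_⟩
  have hx : (Pi.single 0 (n : ℤ) : Site 3) ≠ 0 := by
    intro h0
    have := congr_fun h0 0
    simp at this
    omega
  have h1 := (hb _ hx).1
  have hnorm : ‖(Pi.single 0 (n : ℤ) : Site 3)‖ = (n : ℝ) := by
    rw [Pi.norm_single, Int.norm_natCast]
  rw [hnorm, show (-(((3 : ℕ) : ℝ) - 1)) = (-2 : ℝ) by norm_num, Real.rpow_neg (by positivity),
    Real.rpow_two] at h1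
  rwa [div_eq_mul_inv]

/-! ## The stub -/

/-- **Stub `stub_twoPointToolkit` of reshape 2** — the block-variance toolkit from the route's cruxes:
`DilationJoinings → UniformRegularity → TwoPointToolkit`. `BlockLimits` (`blockLimits_of_joinings`) at order `2`
feeds `stub_twoPointScaling_of_lattice`, whose outputs `m⁶ g(m)/V(m) → Φ > 0`, `g(2m)/g(m) → r` give
`V(2m)/V(m) → 64 r ≥ 16` (`r ≥ 1/4` by the infrared lower bound `g(n) ≥ c n⁻²`); so eventually
`12 V(m) ≤ V(2m) ≤ (64r+1) V(m)`, whence upper doubling and, by dyadic iteration (`2^{7/2} < 12`, `V` monotone),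
`V(ℓ) L^{7/2} ≤ 12 ℓ^{7/2} V(L)`; `A = max (64 r + 1) 12`. [folklore] -/
theorem stub_twoPointToolkit : Sig.stub_twoPointToolkit := by
  intro hDJ hUR
  have hBL : BlockLimits := blockLimits_of_joinings hDJ hUR
  have hBTL : BlockTwoLimits := fun k hk => hBL 2 le_rfl k hk
  obtain ⟨⟨Φ, hΦ, hφ⟩, hratio⟩ :=
    stub_twoPointScaling_of_lattice stub_blockCovAlgebra stub_blockCovTwoPointBounds hBTL
  obtain ⟨r, -, hr⟩ := hratio 2 (by norm_num)
  obtain ⟨c, hc, hIR⟩ := axis_lower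
  unfold TwoPointToolkit
  exact toolkit_abstract (g := fun m : ℕ => criticalTwoPoint 3 (Pi.single 0 (m : ℤ)))
    (V := fun L : ℕ => blockCov L 0) criticalTwoPoint_axis_pos blockCov_zero_pos blockCov_zero_monotone
    hc hIR hΦ hφ hr

end Summit.CriticalPhenomena.Ising3DConformalLimit.Cruxes.RotationJoining.RateSplitting

end
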